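import Literature.MathematicalPhysics.QuantumFieldTheory.Borinsky2020.HeppSectorDecomposition
import Literature.MathematicalPhysics.QuantumFieldTheory.Borinsky2020.ConeIntegral
import HarnessLib

/-!
# Binoth–Heinrich 2000, Part II «Iterated sector decomposition»: ONE iteration — II.2 (the `r` subsectors of an `r`-cube), II.3 (the remap onto the unit cube with «Jacobian factor t_{α_k}^{r−1}») and «by construction t_{α_k} factorizes» — PROVED

Source [BinothHeinrich2000]: T. Binoth, G. Heinrich, "An automatized algorithm to compute infrared divergent
multi-loop integrals", Nucl. Phys. B 585 (2000) 741–759, doi:10.1016/s0550-3213(00)00429-6 = arXiv:hep-ph/0004013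
(v2; e-print source `sd_replaced170701.tex` deposited on the pub-qed HOME, `data/lit/sources/.cache/hep-ph_0004013/`,
PDF page texts `…/arxiv-pdf-pages/hep-ph_0004013v2/`). Part I (primary sectors) is typed in
`Borinsky2020/HeppSectorDecomposition.lean` (`primarySector`, `integral_eq_sum_integral_primarySector`) and Part III
(extraction of the poles) in `BinothHeinrich2000/PoleExtraction.lean`, whose header lists «Part II's decomposition
strategy and its termination» as NOT typed. This file types the decomposition STEP of Part II — the two identities
II.2 and II.3 and the factorisation sentence —, not the strategy II.1 (the choice of 𝒮) nor the termination of the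
iteration. **Part II, VERBATIM** (arXiv v2 p. 5–6; tex l.369–427): «The second part of the algorithm consists of the
iterated application of sector decomposition and a remapping of parameter space to the unit cube in order to
disentangle the overlapping singular regions of the integrands. Starting with Eq. (EQ:primary_sectors) one repeats the
following steps until complete separation of overlapping regions is achieved. II.1: Determine a minimal set of
parameters, say 𝒮 = {t_{α_1}, …, t_{α_r}}, such that 𝒰_l, respectively ℱ_l, vanish if the parameters of 𝒮 are set
to zero. 𝒮 is generally not unique. Additional selection criteria can be introduced to choose an 𝒮 which does not
lead to a large number of subsequent sector decompositions. II.2: Decompose the corresponding r-cube into r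
subsectors.
  Π_{j=1}^r θ(1 ≥ t_{α_j} ≥ 0) = Σ_{k=1}^r Π_{j=1, j≠k}^r θ(t_{α_k} ≥ t_{α_j} ≥ 0)
II.3: Remap the variables to the unit cube in each new subsector by substituting
  t_{α_j} → t_{α_k} t_{α_j} (j ≠ k), t_{α_k} (j = k).
This gives a Jacobian factor of t_{α_k}^{r−1}. By construction t_{α_k} factorizes at least from one of the functions
𝒰_l, ℱ_l. The resulting subsector integrals have the general form
  (EQ:subsec_form)  G_{lk} = ∫_0^1 d^{N−1}t (Π_{j=1}^{N−1} t_j^{A_j − B_j ε}) 𝒰_{lk}^{N−(L+1)D/2} / ℱ_{lk}^{N−LD/2}, k = 1, …, r.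
For each subsector the above steps have to be repeated as long as a set 𝒮 can be found such that one of the functions
𝒰_{l…}, ℱ_{l…} vanishes if the elements of 𝒮 are set to zero. In each subsector new subsectors are created,
resulting in a tree-like structure after a certain number of iterations. The book-keeping can be done with respective
multi-indices. The iteration stops if the functions 𝒰_{lk_1k_2…}, ℱ_{lk_1k_2…} contain a constant term, i.e. if they
are of the following schematic form (EQ:subsec_UF) 𝒰_{lk_1k_2…} = 1 + u(t), ℱ_{lk_1k_2…} = −s_0 + Σ_β (−s_β) f_β(t)».

TYPING. The `N − 1` sector variables are `t : Fin m → ℝ`; the set 𝒮 is a `Finset (Fin m)` (`S`, `r = S.card`, the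
decomposing variable `t_{α_k}` is `k ∈ S`); the unit cube is the OPEN cube `unitCube m = (0,1)^m` of
`Borinsky2020/ConeIntegral.lean` (the printed closed cube `[0,1]^{N−1}` differs by a null set; the `Set.Icc 0 1` form is
`integral_Icc_eq_sum_integral_remap`); subsector `k` is `{t | ∀ j ∈ S, t j ≤ t k}` («Π_{j≠k} θ(t_{α_k} ≥ t_{α_j} ≥ 0)»,
the positivity and `≤ 1` belonging to the cube); the remap of II.3 is written in place as
`fun t j => if j ∈ S.erase k then t k * t j else t j` (variables outside 𝒮 untouched); its Jacobian matrix `∂ρ_i/∂t_j` is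
the local notation `𝐉[S, k, t]`; NO new definition is introduced (D-0026 economy). II.1's «vanish if the parameters of 𝒮
are set to zero» is typed for a polynomial `p : MvPolynomial (Fin m) ℝ` as «every monomial of p contains a variable of 𝒮»
(`∀ d ∈ p.support, ∃ j ∈ S, d j ≠ 0`) — for a polynomial the two are equivalent (the restriction to `t_𝒮 = 0` is the sum
of the monomials with `d|_𝒮 = 0`). The exponents `N−(L+1)D/2`, `N−LD/2`, `A_j − B_j ε` play no role in the step and are
not modelled: II.2/II.3 hold for ANY integrand `f` on the cube.

PROVED (0 named facts, 0 definitions; Mathlib + `Borinsky2020/HeppSectorDecomposition.lean` (the null ties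
`volume_setOf_apply_eq_apply`, `ae_injective`) + `Borinsky2020/ConeIntegral.lean` (`coneMap`, `unitCube`)):
* **II.2**: `measurableSet_subsector`, `eq_of_mem_subsector_of_injective` / `sum_indicator_subsector` (off the ties a point
  lies in exactly one subsector), **`integral_eq_sum_integral_subsector`** (`∫ f dμ = Σ_{k∈𝒮} ∫_{{t_j ≤ t_k ∀ j∈𝒮}} f dμ`
  for every `μ ≪ λ`, `f ∈ L¹(μ)`), **`setIntegral_eq_sum_setIntegral_inter_subsector`** (the same on any domain `D`, e.g. the
  cube), `volume_subsector_inter` (two subsectors meet in a null set);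
* **II.3**: `hasFDerivAt_remap` (the remap is differentiable with derivative `𝐉`), **`det_remapMatrix`** («This gives a
  Jacobian factor of t_{α_k}^{r−1}»: `det 𝐉 = t_k^{|𝒮|−1}`, Laplace expansion along the unchanged row `k`), `injOn_remap`,
  **`remap_image`** (the remap carries the open cube ONTO the open subsector `{u_j < u_k, j ∈ 𝒮∖k}`; inverse `t_j = u_j/u_k`),
  **`setIntegral_subsector_eq_integral_remap`** (`∫_{subsector k ∩ cube} f = ∫_{cube} t_k^{r−1} f(ρ_k t) dt` for ANY `f`,
  Mathlib's change-of-variables theorem `integral_image_eq_integral_abs_det_fderiv_smul`), `subsector_lt_ae_eq_le`;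
* **II.2 + II.3, one iteration**: **`integral_unitCube_eq_sum_integral_remap`** (`∫_{(0,1)^m} f = Σ_{k∈𝒮} ∫_{(0,1)^m}
  t_k^{r−1} f(ρ_k t) dt` for `f` integrable on the cube) and **`integral_Icc_eq_sum_integral_remap`** (the same on `[0,1]^m`);
* **«By construction t_{α_k} factorizes»**: **`eval_remap_eq_mul_of_vanishing`** (`p(ρ_k t) = t_k · q(t)` with the explicit
  `q = Σ_d c_d t^{d'}`, `d'_k = Σ_{j∈𝒮} d_j − 1`, for every `p` all of whose monomials meet 𝒮).
NOT typed: II.1 as a STRATEGY (which minimal 𝒮 to choose; «𝒮 is generally not unique») and the TERMINATION of the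
iteration («one repeats the following steps until complete separation», «The iteration stops if … contain a constant
term») — Binoth–Heinrich's rule can loop; terminating strategies are Bogner–Weinzierl, Comput. Phys. Commun. 178 (2008)
596 = arXiv:0709.4092 §4 (Hironaka's polyhedra game), already on the track's source sheet; the multi-index bookkeeping
of the tree of subsectors; the exponent bookkeeping `A_j, B_j` of (EQ:subsec_form) across iterations (one step's
contribution is `t_k^{r−1}` times the factored powers of `t_k` — `det_remapMatrix` and `eval_remap_eq_mul_of_vanishing`);
Part I with the δ-function (the projective measure) and Part IV; anything about a signed sum of sector integrals or a
subtracted integrand. Filed by the pub-qed TROPICAL literature seat `pub-qed-trop-lit` gen 28 as the kernel object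
behind `tropical/lit/SOURCES.md` §4.3 (A29); VALUE-FREE (identities about integrals over the unit cube and polynomial
algebra; nothing per graph, word or class); independent recomputation; certified where stated, statistical where
stated; no new-physics claim.
-/

noncomputable section

namespace Literature.MathematicalPhysics.QuantumFieldTheory.BinothHeinrich2000

open MeasureTheory Set Real Finset Matrix
open Literature.MathematicalPhysics.QuantumFieldTheory.Borinsky2020

variable {m : ℕ}

/-! ## II.2: the `r` subsectors `{t_{α_k} ≥ t_{α_j} for all α_j ∈ 𝒮}` -/

/-- The subsector `{t : t_j ≤ t_k for all j ∈ 𝒮}` is measurable. Plumbing. [cite: BinothHeinrich2000, Part II, II.2 (tex l.386–391)] -/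
theorem measurableSet_subsector (S : Finset (Fin m)) (k : Fin m) :
    MeasurableSet {t : Fin m → ℝ | ∀ j ∈ S, t j ≤ t k} := by
  have h : {t : Fin m → ℝ | ∀ j ∈ S, t j ≤ t k} = ⋂ j ∈ S, {t : Fin m → ℝ | t j ≤ t k} := by
    ext t
    simp
  rw [h]
  exact S.measurableSet_biInter fun j _ => measurableSet_le (measurable_pi_apply j) (measurable_pi_apply k)

/-- Off the ties a point lies in exactly one subsector: if `t` is injective, `k, l ∈ 𝒮` and `t` is maximal on `𝒮` both at `k` and at
`l`, then `k = l`. [cite: BinothHeinrich2000, Part II, II.2 (tex l.386–391)] -/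
theorem eq_of_mem_subsector_of_injective {S : Finset (Fin m)} {t : Fin m → ℝ} (ht : Function.Injective t) {k l : Fin m}
    (hk : k ∈ S) (hl : l ∈ S) (hkS : ∀ j ∈ S, t j ≤ t k) (hlS : ∀ j ∈ S, t j ≤ t l) : k = l :=
  ht (le_antisymm (hlS k hk) (hkS l hl))

/-- Off the ties, `Σ_{k∈𝒮} 𝟙_{t_k = max_𝒮 t} · f = f` (exactly one term survives) — the pointwise content of
"Π_{j=1}^r θ(1 ≥ t_{α_j} ≥ 0) = Σ_{k=1}^r Π_{j≠k} θ(t_{α_k} ≥ t_{α_j} ≥ 0)". [cite: BinothHeinrich2000, Part II, II.2 (tex l.386–391)] -/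
theorem sum_indicator_subsector {E : Type*} [AddCommMonoid E] (S : Finset (Fin m)) (hS : S.Nonempty) {t : Fin m → ℝ}
    (ht : Function.Injective t) (f : (Fin m → ℝ) → E) :
    ∑ k ∈ S, ({t : Fin m → ℝ | ∀ j ∈ S, t j ≤ t k}).indicator f t = f t := by
  obtain ⟨k₀, hk₀, hmax⟩ := Finset.exists_max_image S t hS
  rw [Finset.sum_eq_single_of_mem k₀ hk₀]
  · exact Set.indicator_of_mem (show t ∈ {t : Fin m → ℝ | ∀ j ∈ S, t j ≤ t k₀} from hmax) f
  · intro k hk hne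
    rw [Set.indicator_of_notMem]
    intro hmem
    exact hne (eq_of_mem_subsector_of_injective ht hk hk₀ hmem hmax)

/-- **II.2, "Decompose the corresponding r-cube into r subsectors"**: for every measure `μ ≪ λ` on the parameter space and every
`μ`-integrable `f`, `∫ f dμ = Σ_{k∈𝒮} ∫_{{t_j ≤ t_k ∀ j∈𝒮}} f dμ` ("Π_{j=1}^r θ(1 ≥ t_{α_j} ≥ 0) = Σ_{k=1}^r Π_{j≠k} θ(t_{α_k} ≥ t_{α_j}
≥ 0)": the subsectors cover everything and meet only on the null ties `{t_k = t_l}`). [cite: BinothHeinrich2000, Part II, II.2 (tex l.386–391)] -/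
theorem integral_eq_sum_integral_subsector {E : Type*} [NormedAddCommGroup E] [NormedSpace ℝ E] (S : Finset (Fin m))
    (hS : S.Nonempty) {μ : Measure (Fin m → ℝ)} (hμ : μ ≪ volume) {f : (Fin m → ℝ) → E} (hf : Integrable f μ) :
    ∫ t, f t ∂μ = ∑ k ∈ S, ∫ t in {t : Fin m → ℝ | ∀ j ∈ S, t j ≤ t k}, f t ∂μ := by
  have hae : (fun t => ∑ k ∈ S, ({t : Fin m → ℝ | ∀ j ∈ S, t j ≤ t k}).indicator f t) =ᵐ[μ] f := by
    filter_upwards [ae_injective hμ] with t ht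
    exact sum_indicator_subsector S hS ht f
  calc ∫ t, f t ∂μ = ∫ t, ∑ k ∈ S, ({t : Fin m → ℝ | ∀ j ∈ S, t j ≤ t k}).indicator f t ∂μ :=
        (integral_congr_ae hae).symm
    _ = ∑ k ∈ S, ∫ t, ({t : Fin m → ℝ | ∀ j ∈ S, t j ≤ t k}).indicator f t ∂μ :=
        integral_finsetSum _ fun k _ => hf.indicator (measurableSet_subsector S k)
    _ = ∑ k ∈ S, ∫ t in {t : Fin m → ℝ | ∀ j ∈ S, t j ≤ t k}, f t ∂μ :=
        Finset.sum_congr rfl fun k _ => integral_indicator (measurableSet_subsector S k)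

/-- **II.2 on a parameter domain** (the unit cube of BH00, or any measurable `D`): `∫_D f = Σ_{k∈𝒮} ∫_{D ∩ {t_j ≤ t_k ∀ j∈𝒮}} f`.
[cite: BinothHeinrich2000, Part II, II.2 (tex l.386–391)] -/
theorem setIntegral_eq_sum_setIntegral_inter_subsector {E : Type*} [NormedAddCommGroup E] [NormedSpace ℝ E]
    (S : Finset (Fin m)) (hS : S.Nonempty) {D : Set (Fin m → ℝ)} {f : (Fin m → ℝ) → E} (hf : IntegrableOn f D volume) :
    ∫ t in D, f t = ∑ k ∈ S, ∫ t in D ∩ {t : Fin m → ℝ | ∀ j ∈ S, t j ≤ t k}, f t := by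
  have hμ : (volume.restrict D : Measure (Fin m → ℝ)) ≪ volume :=
    Measure.absolutelyContinuous_of_le Measure.restrict_le_self
  rw [integral_eq_sum_integral_subsector S hS hμ hf]
  refine Finset.sum_congr rfl fun k _ => ?_
  rw [Measure.restrict_restrict (measurableSet_subsector S k), Set.inter_comm]

/-- "The intersection of two different sectors is of measure zero": two different subsectors meet inside the tie `{t_k = t_l}`.
[cite: BinothHeinrich2000, Part II, II.2 (tex l.386–391)] -/
theorem volume_subsector_inter {S : Finset (Fin m)} {k l : Fin m} (hk : k ∈ S) (hl : l ∈ S) (hkl : k ≠ l) :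
    volume ({t : Fin m → ℝ | ∀ j ∈ S, t j ≤ t k} ∩ {t : Fin m → ℝ | ∀ j ∈ S, t j ≤ t l}) = 0 := by
  refine measure_mono_null ?_ (volume_setOf_apply_eq_apply hkl)
  rintro t ⟨h1, h2⟩
  exact le_antisymm (h2 k hk) (h1 l hl)

/-! ## II.3: the remap `t_{α_j} → t_{α_k} t_{α_j}` (`j ≠ k`) onto the unit cube and its Jacobian `t_{α_k}^{r−1}` -/

/-- The Jacobian matrix of the remap `ρ_k : t_j ↦ t_k t_j (j ∈ 𝒮∖{k}), t_j ↦ t_j (otherwise)`: `∂ρ_i/∂t_j`. Local notation only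
(no new definition). [cite: BinothHeinrich2000, Part II, II.3 (tex l.392–401)] -/
local notation3 "𝐉[" S "," k "," t "]" => (Matrix.of fun i j : Fin _ =>
  if i ∈ Finset.erase S k then ((if j = i then (t : Fin _ → ℝ) k else 0) + (if j = k then t i else 0)) else (if j = i then (1 : ℝ) else 0))

/-- The remap is differentiable with derivative `𝐉` ("substituting t_{α_j} → t_{α_k} t_{α_j} for j ≠ k"). Elementary calculus.
[cite: BinothHeinrich2000, Part II, II.3 (tex l.392–401)] -/
theorem hasFDerivAt_remap (S : Finset (Fin m)) (k : Fin m) (t : Fin m → ℝ) :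
    HasFDerivAt (fun (t : Fin m → ℝ) (j : Fin m) => if j ∈ S.erase k then t k * t j else t j) (coneMap 𝐉[S, k, t]) t := by
  have hproj : ∀ i : Fin m, HasFDerivAt (fun f : Fin m → ℝ => f i)
      (ContinuousLinearMap.proj (R := ℝ) (φ := fun _ : Fin m => ℝ) i) t := fun i => hasFDerivAt_apply i t
  have h : HasFDerivAt (fun (t : Fin m → ℝ) (j : Fin m) => if j ∈ S.erase k then t k * t j else t j)
      (ContinuousLinearMap.pi fun j => if j ∈ S.erase k then
        (t k • ContinuousLinearMap.proj (R := ℝ) (φ := fun _ : Fin m => ℝ) j +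
          t j • ContinuousLinearMap.proj (R := ℝ) (φ := fun _ : Fin m => ℝ) k)
        else ContinuousLinearMap.proj (R := ℝ) (φ := fun _ : Fin m => ℝ) j) t := by
    rw [hasFDerivAt_pi]
    intro j
    by_cases hj : j ∈ S.erase k
    · simp only [hj, if_true]
      -- derivative of `t ↦ t k * t j` is `t k • proj j + t j • proj k`
      exact (hproj k).mul (hproj j)
    · simp only [hj, if_false]
      exact hproj j
  have heq : (ContinuousLinearMap.pi fun j => if j ∈ S.erase k then
        (t k • ContinuousLinearMap.proj (R := ℝ) (φ := fun _ : Fin m => ℝ) j +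
          t j • ContinuousLinearMap.proj (R := ℝ) (φ := fun _ : Fin m => ℝ) k)
        else ContinuousLinearMap.proj (R := ℝ) (φ := fun _ : Fin m => ℝ) j) = coneMap 𝐉[S, k, t] := by
    ext v i
    simp only [coneMap_apply, Matrix.mulVec, dotProduct, Matrix.of_apply, ContinuousLinearMap.pi_apply]
    by_cases hi : i ∈ S.erase k
    · simp [hi, add_mul, ite_mul, Finset.sum_add_distrib, Finset.sum_ite_eq']
    · simp [hi, ite_mul, Finset.sum_ite_eq']
  rw [← heq]
  exact h

/-- **"This gives a Jacobian factor of t_{α_k}^{r−1}"**: `det 𝐉 = t_k^{r−1}`, `r = |𝒮|` (Laplace expansion along the row of `t_{α_k}`,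
which the remap leaves unchanged; the remaining minor is diagonal with `r − 1` entries `t_{α_k}` and `1`'s).
[cite: BinothHeinrich2000, Part II, II.3 (tex l.399)] -/
theorem det_remapMatrix {S : Finset (Fin m)} {k : Fin m} (hk : k ∈ S) (t : Fin m → ℝ) :
    (𝐉[S, k, t]).det = t k ^ (S.card - 1) := by
  obtain ⟨m', rfl⟩ : ∃ m', m = m' + 1 := ⟨m - 1, by have := k.pos; omega⟩
  rw [Matrix.det_succ_row _ k, Finset.sum_eq_single k]
  · -- the `k`-th row of `𝐉` is `e_k`
    have hkk : (𝐉[S, k, t]) k k = 1 := by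
      simp [Matrix.of_apply, Finset.mem_erase]
    rw [hkk, mul_one]
    have hsign : (-1 : ℝ) ^ ((k : ℕ) + (k : ℕ)) = 1 := by
      rw [← two_mul, pow_mul]
      simp
    rw [hsign, one_mul]
    -- the minor is diagonal
    have hsub : (𝐉[S, k, t]).submatrix k.succAbove k.succAbove =
        Matrix.diagonal fun i => if k.succAbove i ∈ S.erase k then t k else 1 := by
      ext i j
      simp only [Matrix.submatrix_apply, Matrix.of_apply, Matrix.diagonal_apply]
      have hne : k.succAbove j ≠ k := Fin.succAbove_ne k j
      simp only [hne, if_false, add_zero, Fin.succAbove_right_inj]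
      by_cases hi : k.succAbove i ∈ S.erase k
      · simp only [hi, if_true]
        by_cases hij : i = j
        · subst hij; simp
        · simp [hij, Ne.symm hij]
      · simp only [hi, if_false]
        by_cases hij : i = j
        · subst hij; simp
        · simp [hij, Ne.symm hij]
    rw [hsub, Matrix.det_diagonal, Finset.prod_ite, Finset.prod_const_one, mul_one, Finset.prod_const]
    congr 1
    -- `#{i : k.succAbove i ∈ 𝒮∖{k}} = |𝒮| − 1`
    have hmap : (Finset.univ.filter fun i : Fin m' => k.succAbove i ∈ S.erase k).map
        ⟨k.succAbove, Fin.succAbove_right_injective⟩ = S.erase k := by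
      ext j
      simp only [Finset.mem_map, Finset.mem_filter, Finset.mem_univ, true_and, Function.Embedding.coeFn_mk]
      constructor
      · rintro ⟨i, hi, rfl⟩
        exact hi
      · intro hj
        obtain ⟨i, hi⟩ := Fin.exists_succAbove_eq (Finset.ne_of_mem_erase hj)
        exact ⟨i, by rw [hi]; exact hj, hi⟩
    rw [← Finset.card_map ⟨k.succAbove, Fin.succAbove_right_injective⟩, hmap, Finset.card_erase_of_mem hk]
  · intro j _ hjk
    have h0 : (𝐉[S, k, t]) k j = 0 := by
      simp [Matrix.of_apply, Finset.mem_erase, hjk]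
    rw [h0, mul_zero, zero_mul]
  · intro h
    exact absurd (Finset.mem_univ k) h

/-- The remap is injective on `{t_k ≠ 0}`, in particular on the open unit cube. [cite: BinothHeinrich2000, Part II, II.3 (tex l.392–401)] -/
theorem injOn_remap (S : Finset (Fin m)) (k : Fin m) :
    Set.InjOn (fun (t : Fin m → ℝ) (j : Fin m) => if j ∈ S.erase k then t k * t j else t j) (unitCube m) := by
  intro a ha b hb h
  have hk : a k = b k := by
    have := congr_fun h k
    simpa [Finset.mem_erase] using this
  funext j
  have hj := congr_fun h j
  by_cases hjS : j ∈ S.erase k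
  · simp only [hjS, if_true] at hj
    rw [hk] at hj
    exact mul_left_cancel₀ (mem_unitCube.mp hb k).1.ne' hj
  · simpa [hjS] using hj

/-- **The remap carries the unit cube onto the subsector** ("Remap the variables to the unit cube in each new subsector"): the image of
the open cube `(0,1)^m` under `ρ_k` is `{u ∈ (0,1)^m : u_j < u_k for j ∈ 𝒮∖{k}}` — the open subsector `k` (inverse: `t_j = u_j/u_k`).
[cite: BinothHeinrich2000, Part II, II.3 (tex l.392–401)] -/
theorem remap_image {S : Finset (Fin m)} (k : Fin m) :
    (fun (t : Fin m → ℝ) (j : Fin m) => if j ∈ S.erase k then t k * t j else t j) '' unitCube m =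
      unitCube m ∩ {u : Fin m → ℝ | ∀ j ∈ S.erase k, u j < u k} := by
  ext u
  constructor
  · rintro ⟨t, ht, rfl⟩
    have ht' := mem_unitCube.mp ht
    refine ⟨mem_unitCube.mpr fun j => ?_, fun j hj => ?_⟩
    · by_cases hj : j ∈ S.erase k
      · simp only [hj, if_true]
        exact ⟨mul_pos (ht' k).1 (ht' j).1, by nlinarith [(ht' k).1, (ht' k).2, (ht' j).1, (ht' j).2]⟩
      · simp only [hj, if_false]
        exact ht' j
    · have hkk : k ∉ S.erase k := Finset.notMem_erase k S
      simp only [hj, if_true, hkk, if_false]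
      nlinarith [(ht' k).1, (ht' j).2]
  · rintro ⟨hu, hlt⟩
    have hu' := mem_unitCube.mp hu
    refine ⟨fun j => if j ∈ S.erase k then u j / u k else u j, mem_unitCube.mpr fun j => ?_, ?_⟩
    · by_cases hj : j ∈ S.erase k
      · simp only [hj, if_true]
        exact ⟨div_pos (hu' j).1 (hu' k).1, (div_lt_one (hu' k).1).mpr (hlt j hj)⟩
      · simp only [hj, if_false]
        exact hu' j
    · funext j
      have hkk : k ∉ S.erase k := Finset.notMem_erase k S
      by_cases hj : j ∈ S.erase k
      · simp only [hj, if_true, hkk, if_false]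
        field_simp [(hu' k).1.ne']
      · simp only [hj, if_false]

/-- **II.3 as an integral identity — "This gives a Jacobian factor of t_{α_k}^{r−1}"**: for `k ∈ 𝒮`, `r = |𝒮|` and ANY integrand `f`,
`∫_{u ∈ (0,1)^m, u_j < u_k (j∈𝒮∖k)} f(u) du = ∫_{t ∈ (0,1)^m} t_k^{r−1} f(ρ_k t) dt`, `ρ_k t = (t_k t_j)_{j∈𝒮∖k} ∪ (t_j)_{else}`
(Mathlib's change-of-variables theorem with the Jacobian `det_remapMatrix`). [cite: BinothHeinrich2000, Part II, II.3 (tex l.392–407)] -/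
theorem setIntegral_subsector_eq_integral_remap {S : Finset (Fin m)} {k : Fin m} (hk : k ∈ S) (f : (Fin m → ℝ) → ℝ) :
    ∫ u in unitCube m ∩ {u : Fin m → ℝ | ∀ j ∈ S.erase k, u j < u k}, f u =
      ∫ t in unitCube m, t k ^ (S.card - 1) * f (fun j => if j ∈ S.erase k then t k * t j else t j) := by
  have hderiv : ∀ t ∈ unitCube m, HasFDerivWithinAt (fun (t : Fin m → ℝ) (j : Fin m) => if j ∈ S.erase k then t k * t j else t j)
      (coneMap 𝐉[S, k, t]) (unitCube m) t := fun t _ => (hasFDerivAt_remap S k t).hasFDerivWithinAt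
  have h := integral_image_eq_integral_abs_det_fderiv_smul volume measurableSet_unitCube hderiv (injOn_remap S k) f
  rw [remap_image] at h
  rw [h]
  refine setIntegral_congr_fun measurableSet_unitCube fun t ht => ?_
  rw [det_coneMap, det_remapMatrix hk, abs_of_nonneg (pow_nonneg (mem_unitCube.mp ht k).1.le _), smul_eq_mul]

/-- The open subsector `{u_j < u_k}` and the closed one `{u_j ≤ u_k}` differ, inside the cube, by a null set (the ties). Plumbing.
[cite: BinothHeinrich2000, Part II, II.2 (tex l.386–391)] -/
theorem subsector_lt_ae_eq_le (S : Finset (Fin m)) (k : Fin m) :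
    (unitCube m ∩ {u : Fin m → ℝ | ∀ j ∈ S.erase k, u j < u k} : Set (Fin m → ℝ)) =ᵐ[volume]
      (unitCube m ∩ {u : Fin m → ℝ | ∀ j ∈ S, u j ≤ u k} : Set (Fin m → ℝ)) := by
  have hsub : unitCube m ∩ {u : Fin m → ℝ | ∀ j ∈ S.erase k, u j < u k} ⊆
      unitCube m ∩ {u : Fin m → ℝ | ∀ j ∈ S, u j ≤ u k} := by
    rintro u ⟨hu, h⟩
    refine ⟨hu, fun j hj => ?_⟩
    by_cases hjk : j = k
    · rw [hjk]
    · exact (h j (Finset.mem_erase.mpr ⟨hjk, hj⟩)).le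
  refine ae_eq_set.mpr ⟨?_, ?_⟩
  · exact measure_mono_null (fun u hu => (hu.2 (hsub hu.1)).elim) measure_empty
  · refine measure_mono_null ?_ ((measure_biUnion_null_iff (S.erase k).countable_toSet).mpr
      fun j hj => volume_setOf_apply_eq_apply (Finset.ne_of_mem_erase hj))
    rintro u ⟨⟨hu, hle⟩, hnot⟩
    simp only [Set.mem_inter_iff, Set.mem_setOf_eq, not_and] at hnot
    have h' := hnot hu
    push Not at h'
    obtain ⟨j, hj, hjk⟩ := h'
    exact Set.mem_biUnion hj (le_antisymm (hle j (Finset.mem_of_mem_erase hj)) hjk)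

/-- **Part II, one iteration (II.2 + II.3) on the open unit cube**: for a non-empty set `𝒮` of parameters, `r = |𝒮|`, and every `f`
integrable on the cube, `∫_{(0,1)^m} f(t) dt = Σ_{k∈𝒮} ∫_{(0,1)^m} t_k^{r−1} f(ρ_k t) dt` with the remap `ρ_k t = (t_k t_j for j ∈ 𝒮∖{k};
t_j otherwise)` — "Decompose the corresponding r-cube into r subsectors … Remap the variables to the unit cube in each new subsector by
substituting t_{α_j} → t_{α_k} t_{α_j} (j ≠ k), t_{α_k} (j = k). This gives a Jacobian factor of t_{α_k}^{r−1}."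
[cite: BinothHeinrich2000, Part II, II.2–II.3 (tex l.386–407) (= Nucl. Phys. B 585 (2000) 741, §2 Part II; arXiv hep-ph/0004013v2 p.5–6)] -/
theorem integral_unitCube_eq_sum_integral_remap (S : Finset (Fin m)) (hS : S.Nonempty) {f : (Fin m → ℝ) → ℝ}
    (hf : IntegrableOn f (unitCube m) volume) :
    ∫ t in unitCube m, f t =
      ∑ k ∈ S, ∫ t in unitCube m, t k ^ (S.card - 1) * f (fun j => if j ∈ S.erase k then t k * t j else t j) := by
  rw [setIntegral_eq_sum_setIntegral_inter_subsector S hS hf]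
  refine Finset.sum_congr rfl fun k hk => ?_
  rw [← setIntegral_congr_set (subsector_lt_ae_eq_le S k), setIntegral_subsector_eq_integral_remap hk f]

/-- **The same on the closed cube `[0,1]^m` of the print** ("G_{lk} = ∫_0^1 d^{N−1}t …"; the boundary is Lebesgue-null).
[cite: BinothHeinrich2000, Part II, II.2–II.3 and eq. (EQ:subsec_form) (tex l.386–407)] -/
theorem integral_Icc_eq_sum_integral_remap (S : Finset (Fin m)) (hS : S.Nonempty) {f : (Fin m → ℝ) → ℝ}
    (hf : IntegrableOn f (Set.Icc (0 : Fin m → ℝ) 1) volume) :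
    ∫ t in Set.Icc (0 : Fin m → ℝ) 1, f t =
      ∑ k ∈ S, ∫ t in Set.Icc (0 : Fin m → ℝ) 1, t k ^ (S.card - 1) * f (fun j => if j ∈ S.erase k then t k * t j else t j) := by
  have hae : (unitCube m : Set (Fin m → ℝ)) =ᵐ[volume] Set.Icc (0 : Fin m → ℝ) 1 := by
    rw [unitCube, volume_pi]
    exact Measure.univ_pi_Ioo_ae_eq_Icc (f := fun _ => (0 : ℝ)) (g := fun _ => (1 : ℝ))
  have hf' : IntegrableOn f (unitCube m) volume := hf.congr_set_ae hae
  rw [← setIntegral_congr_set hae, integral_unitCube_eq_sum_integral_remap S hS hf']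
  exact Finset.sum_congr rfl fun k _ => setIntegral_congr_set hae

/-! ## II.1 / II.3: "By construction t_{α_k} factorizes" — from a polynomial that vanishes at `t_𝒮 = 0` -/

/-- **II.1 + II.3, the factorisation**: if a polynomial `p` "vanish[es] if the parameters of 𝒮 are set to zero" in the sense that every
monomial of `p` contains a variable of `𝒮` (the two are equivalent for a polynomial), then after the remap `ρ_k` (`k ∈ 𝒮`) "by
construction t_{α_k} factorizes": `p(ρ_k t) = t_k · q(t)` for every `t`, with the explicit polynomial `q = Σ_d c_d t^{d'}`, `d' = d` off
`k`, `d'_k = (Σ_{j∈𝒮} d_j) − 1` (each monomial `t^d` becomes `t_k^{Σ_{j∈𝒮} d_j} Π_{j≠k} t_j^{d_j}` and `Σ_{j∈𝒮} d_j ≥ 1`).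
[cite: BinothHeinrich2000, Part II, II.1 and II.3 (tex l.379–401: "Determine a minimal set of parameters, say 𝒮 … such that 𝒰_l, respectively ℱ_l, vanish if the parameters of 𝒮 are set to zero", "By construction t_{α_k} factorizes at least from one of the functions")] -/
theorem eval_remap_eq_mul_of_vanishing {S : Finset (Fin m)} {k : Fin m} (hk : k ∈ S) (p : MvPolynomial (Fin m) ℝ)
    (hp : ∀ d ∈ p.support, ∃ j ∈ S, d j ≠ 0) (t : Fin m → ℝ) :
    MvPolynomial.eval (fun j => if j ∈ S.erase k then t k * t j else t j) p =
      t k * MvPolynomial.eval t (∑ d ∈ p.support, MvPolynomial.monomial (d.update k (∑ j ∈ S, d j - 1)) (p.coeff d)) := by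
  classical
  rw [MvPolynomial.eval_eq', map_sum, Finset.mul_sum]
  refine Finset.sum_congr rfl fun d hd => ?_
  rw [MvPolynomial.eval_monomial, Finsupp.prod_fintype _ _ (fun i => pow_zero _)]
  simp only [Finsupp.coe_update]
  -- the exponent of `t_k` after the remap
  have hsum : 1 ≤ ∑ j ∈ S, d j := by
    obtain ⟨j, hj, hj0⟩ := hp d hd
    exact le_trans (Nat.one_le_iff_ne_zero.mpr hj0) (Finset.single_le_sum (fun i _ => Nat.zero_le (d i)) hj)
  -- left: Π_i (ρ t)_i^{d_i} = t_k^{Σ_{𝒮∖k} d} · Π_i t_i^{d_i}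
  have hL : ∏ i, (if i ∈ S.erase k then t k * t i else t i) ^ d i =
      t k ^ (∑ i ∈ S.erase k, d i) * ∏ i, t i ^ d i := by
    have h1 : ∀ i, (if i ∈ S.erase k then t k * t i else t i) ^ d i =
        (if i ∈ S.erase k then t k ^ d i else 1) * t i ^ d i := by
      intro i
      split_ifs
      · rw [mul_pow]
      · rw [one_mul]
    simp only [h1, Finset.prod_mul_distrib]
    congr 1
    rw [← Finset.prod_pow_eq_pow_sum, ← Finset.prod_filter]
    congr 1
    ext i
    simp
  -- right: t_k · Π_i t_i^{d'_i} = t_k^{(Σ_𝒮 d − 1) + 1} · Π_{i≠k} t_i^{d_i}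
  have hR : t k * ∏ i, t i ^ Function.update (⇑d) k (∑ j ∈ S, d j - 1) i =
      t k ^ (∑ j ∈ S, d j) * ∏ i ∈ Finset.univ.erase k, t i ^ d i := by
    rw [← Finset.mul_prod_erase Finset.univ _ (Finset.mem_univ k), Function.update_self]
    have h2 : ∏ i ∈ Finset.univ.erase k, t i ^ Function.update (⇑d) k (∑ j ∈ S, d j - 1) i =
        ∏ i ∈ Finset.univ.erase k, t i ^ d i :=
      Finset.prod_congr rfl fun i hi => by rw [Function.update_of_ne (Finset.ne_of_mem_erase hi)]
    rw [h2, ← mul_assoc, ← pow_succ', Nat.sub_add_cancel hsum]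
  have hL' : ∏ i, t i ^ d i = t k ^ d k * ∏ i ∈ Finset.univ.erase k, t i ^ d i :=
    (Finset.mul_prod_erase Finset.univ (fun i => t i ^ d i) (Finset.mem_univ k)).symm
  rw [hL, hL']
  calc MvPolynomial.coeff d p * ((t k ^ ∑ i ∈ S.erase k, d i) * (t k ^ d k * ∏ i ∈ Finset.univ.erase k, t i ^ d i))
      = MvPolynomial.coeff d p * (t k ^ (∑ i ∈ S.erase k, d i + d k) * ∏ i ∈ Finset.univ.erase k, t i ^ d i) := by
        rw [pow_add]; ring
    _ = MvPolynomial.coeff d p * (t k * ∏ i, t i ^ Function.update (⇑d) k (∑ j ∈ S, d j - 1) i) := by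
        rw [Finset.sum_erase_add _ _ hk, hR]
    _ = _ := by ring

end Literature.MathematicalPhysics.QuantumFieldTheory.BinothHeinrich2000

end
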